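import Literature.AlgebraicGeometry.HodgeTheory.UnitaryReflectionGroupZariskiDense
import Literature.NumberTheory.GaloisRepresentations.ProjectiveTypeProofs
import HarnessLib

/-!
# Two complex reflections of prime order `p ≥ 7` along skew unit roots generate an infinite group
# (Carlson–Toledo 1999 §7, Lemma `Ulemma`, via Klein's finite subgroups of `PGL₂(ℂ)`; all proved)

Family `hodge`, layer `Literature/AlgebraicGeometry/HodgeTheory`; sequel of
`UnitaryReflectionGroupZariskiDense` (Carlson–Toledo's density theorem `udensitytheo` as the named
fact `carlsonToledo1999_unitaryReflection_zariskiDense`: a reflection group along one orbit of unit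
roots spanning `ℂ(p,q)` is FINITE or `PΓ` is Zariski dense in `PU(p,q)`).  This file PROVES the input
that removes the finite branch in the routes' range `p ≥ 7` prime — step R2 of the planner memo
`STUB-PLAN-B2-g19` §2 for the crux K1-A `stub_unitaryReflectionDensity` (`stmt-HodgeConjecture-19544`):
two `λ`-reflections, `λ` of prime order `p ≥ 7`, along linearly independent non-orthogonal unit roots
generate an infinite subgroup of `GL(W)`.  No named fact: the one classical input, Klein's
classification of the finite subgroups of `PGL₂(ℂ)`, is the tree's THEOREM
`Literature.NumberTheory.GaloisRepresentations.klein_finite_subgroup_pgl_two_of_isAlgClosed`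
(`ProjectiveTypeProofs`; also `Serre1972.prop16`).

## Source, verbatim (Carlson–Toledo, *Discriminant complements and kernels of monodromy
## representations*, Duke Math. J. 97 (1999) [CarlsonToledo1999], arXiv text
## `paper:arxiv-alg-geom_9708002` p0015)

* L53–65, **Lemma** (label `Ulemma`): "Let `λ ≠ ±1` be a root of unity, and let `U` be the unitary
  group of a nondegenerate hermitian form on `ℂ²`. Let `δ₁` and `δ₂` be independent vectors with
  nonzero inner product, and let `Γ` be the group generated by complex reflections with common
  eigenvalue `λ`. Then either `Γ` is finite or its image in the projective unitary group is
  Zariski-dense. In the positive-definite case `Γ` is finite if and only if the inner products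
  `(δ₁,δ₂)` lie in a fixed finite set `S` which depends only on `λ` and `h`. In the indefinite case
  `Γ` is never finite."
* L67–77 (proof): "the group `U` acts on the Riemann sphere `ℙ¹` via the natural map `U → PU` […]
  Since `λ` is a root of unity, the projection `PΓ` is a finite group if and only if `Γ` is. The
  finite subgroups of rotations of the sphere are well known. There are two infinite series: the
  cyclic groups, where the vectors `δ` are all proportional, and the dihedral groups where `λ = −1`.
  There are three additional groups, given by the symmetries of the five platonic solids, and `S` is
  the set of possible values of `h(δ₁,δ₂)` that can arise for these three groups."

## What is proved here (the case `ord λ = p ≥ 7` prime, where `S = ∅`)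

The memo's sharpening of the Lemma (STUB-PLAN-B2-g19 §2 R2, refereed REF-STUB-PLAN-B2 §1: "S(λ) = ∅
for ord λ ≥ 7 is a correct sharpening"): the platonic groups `𝔄₄, 𝔖₄, 𝔄₅` have orders `12, 24, 60`,
so contain no element of prime order `p ≥ 7`; in a cyclic or dihedral group two elements of order
`p > 2` commute; and the images of `s_{δ₁}, s_{δ₂}` in `PGL(ℂδ₁ + ℂδ₂)` do not commute unless
`λ² = 1` (coefficient comparison on `δ₁, δ₂`).  Hence:

* `infinite_of_two_complexReflections` — **THE RESULT**: `h` hermitian, `h(δᵢ,δᵢ) = ε = ±1`,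
  `λ^p = 1 ≠ λ`, `p` prime `≥ 7`, `δ₁, δ₂` independent with `h(δ₂,δ₁) ≠ 0` ⇒ every subgroup of
  `GL(W)` containing the two reflections (as automorphisms) is infinite.  (`W` of any dimension; the
  plane `ℂδ₁ + ℂδ₂` need not be non-degenerate — the signature plays no role in this branch.)
* `carlsonToledo1999_unitaryReflection_zariskiDense.mem_glZariskiClosure_of_prime` — the density
  theorem with the finite branch REMOVED: under the hypotheses of `udensitytheo` with `λ` of prime
  order `p ≥ 7` and two independent non-orthogonal roots in `Δ`, every `h`-unitary automorphism lies
  in the real Zariski closure of `Γ·U(1)`.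
* `exists_skew_pair_of_transitive` — a transitive system of unit roots spanning a space of dimension
  `≥ 2` contains two independent non-orthogonal roots; whence
  `carlsonToledo1999_unitaryReflection_zariskiDense.mem_glZariskiClosure_of_prime_order` — the
  density theorem with the finite branch removed under EXACTLY the hypotheses of `udensitytheo` plus
  "`λ` of prime order `p ≥ 7`" (§4, appended).
* Apparatus (proved, reusable): `submoduleStabilizer P ≤ GL(W)`, the restriction homomorphisms
  `restrictEnd : Γ →* End(P)` and `restrictGL : Γ →* GL_ι(K)` (matrices in a basis of `P`) for a
  subgroup stabilising `P`, and `exists_smul_of_restrictGL_mem_center` (central matrix ⇒ `g` is a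
  scalar on `P`), over any field.

## References
* [CarlsonToledo1999] J. A. Carlson, D. Toledo, Duke Math. J. 97 (1999) 621–648, §7 Lemma `Ulemma`
  (arXiv alg-geom/9708002 p. 15). [cite: CarlsonToledo1999, §7 Lemma Ulemma]
* [Serre1972] J.-P. Serre, *Propriétés galoisiennes des points d'ordre fini des courbes
  elliptiques*, Invent. Math. 15 (1972), §2.5 Prop. 16 (finite subgroups of `PGL₂(k)`; Klein 1884)
  — used through the tree's `klein_finite_subgroup_pgl_two_of_isAlgClosed`. [cite: Serre1972, §2.5, Prop. 16]
-/

noncomputable section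

open Module
open scoped MatrixGroups

namespace Literature.AlgebraicGeometry.HodgeTheory

/-! ### §1 Restricting a group of automorphisms to an invariant plane: `Γ → GL₂ → PGL₂` -/

section Restrict

variable {K : Type*} [Field K] {W : Type*} [AddCommGroup W] [Module K W]

/-- The subgroup of `GL(W)` of automorphisms `g` with `x ∈ P ↔ g x ∈ P` — the automorphisms
mapping the subspace `P` onto itself (for the restriction `Γ → GL(P)`; Carlson–Toledo: "the group
`U` acts on the Riemann sphere `ℙ¹` via the natural map `U → PU`"). [cite: CarlsonToledo1999, §7 Lemma Ulemma (p. 15 L67–69)] -/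
def submoduleStabilizer (P : Submodule K W) : Subgroup (W ≃ₗ[K] W) where
  carrier := {g | ∀ x, x ∈ P ↔ g x ∈ P}
  one_mem' := fun _ => Iff.rfl
  mul_mem' := fun {g h} hg hh x => (hh x).trans (hg (h x))
  inv_mem' := fun {g} hg x => by
    have h := hg (g.symm x)
    rw [LinearEquiv.apply_symm_apply] at h
    exact h.symm

/-- [cite: CarlsonToledo1999, §7 Lemma Ulemma (p. 15 L67–69)] -/
theorem mem_submoduleStabilizer_iff (P : Submodule K W) (g : W ≃ₗ[K] W) :
    g ∈ submoduleStabilizer P ↔ ∀ x, x ∈ P ↔ g x ∈ P := Iff.rfl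

/-- Restriction of a subgroup `Γ ≤ GL(W)` stabilising `P` to endomorphisms of `P`, as a monoid
homomorphism. [cite: CarlsonToledo1999, §7 Lemma Ulemma (p. 15 L67–69)] -/
def restrictEnd (P : Submodule K W) (Γ : Subgroup (W ≃ₗ[K] W)) (hΓ : Γ ≤ submoduleStabilizer P) :
    Γ →* Module.End K P where
  toFun g := (g.1 : W →ₗ[K] W).restrict fun x hx => ((hΓ g.2) x).mp hx
  map_one' := by ext x; rfl
  map_mul' _ _ := by ext x; rfl

/-- [cite: CarlsonToledo1999, §7 Lemma Ulemma (p. 15 L67–69)] -/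
@[simp] theorem restrictEnd_apply_coe (P : Submodule K W) (Γ : Subgroup (W ≃ₗ[K] W))
    (hΓ : Γ ≤ submoduleStabilizer P) (g : Γ) (x : P) :
    ((restrictEnd P Γ hΓ g) x : W) = g.1 x := rfl

variable {ι : Type*} [Fintype ι] [DecidableEq ι]

/-- Restriction of `Γ ≤ GL(W)` stabilising `P` to MATRICES: `Γ →* GL_ι(K)` in a basis `b` of `P`
(the map "`U → PU`" of the source before projectivising, `Matrix.ProjGenLinGroup.mk`).
[cite: CarlsonToledo1999, §7 Lemma Ulemma (p. 15 L67–69)] -/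
def restrictGL (P : Submodule K W) (b : Basis ι K P) (Γ : Subgroup (W ≃ₗ[K] W))
    (hΓ : Γ ≤ submoduleStabilizer P) : Γ →* GL ι K :=
  (Units.map ((LinearMap.toMatrixAlgEquiv b).toRingEquiv.toMulEquiv.toMonoidHom.comp
    (restrictEnd P Γ hΓ))).comp (toUnits (G := Γ)).toMonoidHom

/-- [cite: CarlsonToledo1999, §7 Lemma Ulemma (p. 15 L67–69)] -/
theorem coe_restrictGL (P : Submodule K W) (b : Basis ι K P) (Γ : Subgroup (W ≃ₗ[K] W))
    (hΓ : Γ ≤ submoduleStabilizer P) (g : Γ) :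
    ((restrictGL P b Γ hΓ g : GL ι K) : Matrix ι ι K) = LinearMap.toMatrix b b (restrictEnd P Γ hΓ g) :=
  rfl

/-- If the matrix of `g|P` is central in `GL_ι(K)` (i.e. `g|P` is trivial in `PGL`), then `g` acts
on `P` by a scalar (`Matrix.GeneralLinearGroup.center_eq_range_scalar`). [cite: CarlsonToledo1999, §7 Lemma Ulemma (p. 15 L67–72)] -/
theorem exists_smul_of_restrictGL_mem_center (P : Submodule K W) (b : Basis ι K P)
    (Γ : Subgroup (W ≃ₗ[K] W)) (hΓ : Γ ≤ submoduleStabilizer P) {g : Γ}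
    (hg : restrictGL P b Γ hΓ g ∈ Subgroup.center (GL ι K)) :
    ∃ u : K, ∀ x ∈ P, g.1 x = u • x := by
  rw [Matrix.GeneralLinearGroup.center_eq_range_scalar] at hg
  obtain ⟨u, hu⟩ := hg
  refine ⟨(u : K), fun x hx => ?_⟩
  have hmat : LinearMap.toMatrix b b (restrictEnd P Γ hΓ g) =
      LinearMap.toMatrix b b (algebraMap K (Module.End K P) (u : K)) := by
    rw [← coe_restrictGL, ← hu, Matrix.GeneralLinearGroup.coe_scalar, LinearMap.toMatrix_algebraMap]
  have hend : restrictEnd P Γ hΓ g = algebraMap K (Module.End K P) (u : K) :=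
    (LinearMap.toMatrix b b).injective hmat
  have := congrArg (fun f : Module.End K P => ((f ⟨x, hx⟩ : P) : W)) hend
  simpa [Module.algebraMap_end_apply] using this

end Restrict

/-! ### §2 Two `λ`-reflections of prime order `p ≥ 7` along skew unit roots generate an infinite group -/

section PairInfinite

variable {W : Type*} [AddCommGroup W] [Module ℂ W]

/-- `λ^p = 1`, `λ ≠ 1`, `p` a prime `≥ 7` (hence odd) ⇒ `λ² ≠ 1` (i.e. `λ ≠ ±1`, the source's
standing hypothesis "`λ ≠ ±1`"). [cite: CarlsonToledo1999, §7 Lemma Ulemma (p. 15 L53)] -/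
theorem mul_self_ne_one_of_pow_prime_eq_one {l : ℂ} {p : ℕ} (hp : p.Prime) (h7 : 7 ≤ p)
    (hlp : l ^ p = 1) (hl1 : l ≠ 1) : l * l ≠ 1 := by
  intro h
  have hl' : l = -1 := by
    have : (l - 1) * (l + 1) = 0 := by linear_combination h
    rcases mul_eq_zero.mp this with h1 | h1
    · exact absurd (sub_eq_zero.mp h1) hl1
    · linear_combination h1
  rw [hl'] at hlp
  have hodd : Odd p := hp.odd_of_ne_two (by omega)
  rw [hodd.neg_one_pow] at hlp
  norm_num at hlp

/-- A prime `p ≥ 7` divides none of `12 = |𝔄₄|`, `24 = |𝔖₄|`, `60 = |𝔄₅|`: "There are three additional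
groups, given by the symmetries of the five platonic solids" contain no element of order `≥ 6`.
[cite: CarlsonToledo1999, §7 Lemma Ulemma (p. 15 L72–77)] -/
theorem not_dvd_sixty_of_prime_ge_seven {p : ℕ} (hp : p.Prime) (h7 : 7 ≤ p) :
    ¬ p ∣ 12 ∧ ¬ p ∣ 24 ∧ ¬ p ∣ 60 := by
  have h60 : ¬ p ∣ 60 := by
    intro hd
    have hle : p ≤ 60 := Nat.le_of_dvd (by norm_num) hd
    interval_cases p <;> first | omega | norm_num at hp
  refine ⟨fun h => h60 (h.trans (by norm_num)), fun h => ?_, h60⟩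
  have hle : p ≤ 24 := Nat.le_of_dvd (by norm_num) h
  interval_cases p <;> first | omega | norm_num at hp

/-- A `λ`-reflection along a unit root with `λ^p = 1`, viewed in `GL(W)`, satisfies `g^p = 1`.
[cite: CarlsonToledo1999, §7 Theorem udensitytheo] -/
theorem pow_eq_one_of_coe_eq_complexReflection (B : W →ₗ⋆[ℂ] W →ₗ[ℂ] ℂ) {ε : ℂ} (hε : ε * ε = 1)
    {l : ℂ} {p : ℕ} (hlp : l ^ p = 1) {δ : W} (hδ : B δ δ = ε) {g : W ≃ₗ[ℂ] W}
    (hge : (g : W →ₗ[ℂ] W) = complexReflection B ε l δ) : g ^ p = 1 := by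
  apply LinearEquiv.toLinearMap_injective
  have hp : ((g ^ p : W ≃ₗ[ℂ] W) : W →ₗ[ℂ] W) = (g : W →ₗ[ℂ] W) ^ p :=
    map_pow (LinearEquiv.automorphismGroup.toLinearMapMonoidHom (R := ℂ) (M := W)) g p
  rw [hp, hge, complexReflection_pow_eq_one B hε hlp hδ]
  rfl

/-- **Two `λ`-reflections of prime order `p ≥ 7` along independent, non-orthogonal unit roots
generate an INFINITE group** (Carlson–Toledo's Lemma `Ulemma` in the case "`(δ₁, δ₂)` outside `S`",
with the memo's observation that `S(λ) = ∅` once `λ` has prime order `≥ 7`): `h` hermitian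
(`B.IsSymm`; non-degeneracy and signature are not needed), `h(δᵢ,δᵢ) = ε`, `ε² = 1`, `λ^p = 1`,
`λ ≠ 1`, `p` prime `≥ 7`, `δ₁, δ₂` linearly independent with `h(δ₂, δ₁) ≠ 0` (`B δ₁ δ₂ ≠ 0`); then any
subgroup `Γ ≤ GL(W)` containing automorphisms `g₁, g₂` with underlying maps `s_{δ₁}, s_{δ₂}` is
infinite.  Proof: restrict `⟨g₁, g₂⟩` to the invariant plane `P = ℂδ₁ + ℂδ₂` and project to
`PGL₂(ℂ)` ("`U` acts on `ℙ¹` via `U → PU` […] `PΓ` is a finite group if and only if `Γ` is"); the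
images of `g₁, g₂` have prime order `p` and do NOT commute (a projective commutation
`g₁g₂ = u·g₂g₁` on `P` forces, comparing coefficients on `δ₁, δ₂`, first `u = λ` and `ab = 1 − λ`,
then `λ² = 1`, excluded for odd `p`); by Klein's classification of the finite subgroups of `PGL₂(ℂ)`
— the TREE's theorem `klein_finite_subgroup_pgl_two_of_isAlgClosed` ("The finite subgroups of
rotations of the sphere are well known") — a finite image would be cyclic or dihedral (where two
elements of order `> 2` are rotations and commute) or `𝔄₄, 𝔖₄, 𝔄₅` (orders `12, 24, 60`, prime to
`p ≥ 7`), a contradiction.  For `p = 5` the icosahedral group is a genuine exception (the source's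
finite set `S`). [cite: CarlsonToledo1999, §7 Lemma Ulemma (p. 15 L53–92)] -/
theorem infinite_of_two_complexReflections {B : W →ₗ⋆[ℂ] W →ₗ[ℂ] ℂ} (hB : B.IsSymm) {ε : ℂ}
    (hε : ε * ε = 1) {l : ℂ} {p : ℕ} (hp : p.Prime) (h7 : 7 ≤ p) (hlp : l ^ p = 1) (hl1 : l ≠ 1)
    {δ₁ δ₂ : W} (hδ₁ : B δ₁ δ₁ = ε) (hδ₂ : B δ₂ δ₂ = ε) (h12 : B δ₁ δ₂ ≠ 0)
    (hli : LinearIndependent ℂ ![δ₁, δ₂]) {Γ : Subgroup (W ≃ₗ[ℂ] W)} {g₁ g₂ : W ≃ₗ[ℂ] W}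
    (hg₁ : g₁ ∈ Γ) (hg₂ : g₂ ∈ Γ) (hg₁e : (g₁ : W →ₗ[ℂ] W) = complexReflection B ε l δ₁)
    (hg₂e : (g₂ : W →ₗ[ℂ] W) = complexReflection B ε l δ₂) :
    (Γ : Set (W ≃ₗ[ℂ] W)).Infinite := by
  classical
  -- the two off-diagonal scalars
  set a : ℂ := ε * (l - 1) * B δ₁ δ₂ with ha_def
  set c : ℂ := ε * (l - 1) * B δ₂ δ₁ with hc_def
  have hε0 : ε ≠ 0 := by rintro rfl; norm_num at hε
  have h21 : B δ₂ δ₁ ≠ 0 := by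
    rw [← hB.eq δ₁ δ₂]
    exact (map_ne_zero_iff (starRingEnd ℂ) (RingHom.injective _)).mpr h12
  have ha0 : a ≠ 0 := mul_ne_zero (mul_ne_zero hε0 (sub_ne_zero.mpr hl1)) h12
  have hc0 : c ≠ 0 := mul_ne_zero (mul_ne_zero hε0 (sub_ne_zero.mpr hl1)) h21
  have hl2 : l * l ≠ 1 := mul_self_ne_one_of_pow_prime_eq_one hp h7 hlp hl1
  -- pointwise formulas
  have e₁ : ∀ x, g₁ x = x + (ε * (l - 1) * B δ₁ x) • δ₁ := fun x => by
    rw [← LinearEquiv.coe_coe, hg₁e, complexReflection_apply]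
  have e₂ : ∀ x, g₂ x = x + (ε * (l - 1) * B δ₂ x) • δ₂ := fun x => by
    rw [← LinearEquiv.coe_coe, hg₂e, complexReflection_apply]
  have g₁δ₁ : g₁ δ₁ = l • δ₁ := by
    rw [← LinearEquiv.coe_coe, hg₁e, complexReflection_apply_self B hε l hδ₁]
  have g₂δ₂ : g₂ δ₂ = l • δ₂ := by
    rw [← LinearEquiv.coe_coe, hg₂e, complexReflection_apply_self B hε l hδ₂]
  have g₁δ₂ : g₁ δ₂ = δ₂ + a • δ₁ := e₁ δ₂
  have g₂δ₁ : g₂ δ₁ = δ₁ + c • δ₂ := e₂ δ₁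
  -- the plane `P = ℂδ₁ + ℂδ₂` and its basis
  set P : Submodule ℂ W := Submodule.span ℂ (Set.range ![δ₁, δ₂]) with hP_def
  have hδ₁P : δ₁ ∈ P := Submodule.subset_span ⟨0, rfl⟩
  have hδ₂P : δ₂ ∈ P := Submodule.subset_span ⟨1, rfl⟩
  let b : Basis (Fin 2) ℂ P := Basis.span hli
  -- the subgroup generated by the two reflections preserves `P`
  set Γ₀ : Subgroup (W ≃ₗ[ℂ] W) := Subgroup.closure {g₁, g₂} with hΓ₀_def
  have hΓ₀Γ : Γ₀ ≤ Γ := by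
    rw [hΓ₀_def, Subgroup.closure_le]
    rintro g (rfl | rfl)
    · exact hg₁
    · exact hg₂
  have hstab : Γ₀ ≤ submoduleStabilizer P := by
    rw [hΓ₀_def, Subgroup.closure_le]
    rintro g (rfl | rfl)
    · intro x
      rw [e₁ x]
      refine ⟨fun hx => P.add_mem hx (P.smul_mem _ hδ₁P), fun hx => ?_⟩
      have := P.sub_mem hx (P.smul_mem (ε * (l - 1) * B δ₁ x) hδ₁P)
      rwa [add_sub_cancel_right] at this
    · intro x
      rw [e₂ x]
      refine ⟨fun hx => P.add_mem hx (P.smul_mem _ hδ₂P), fun hx => ?_⟩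
      have := P.sub_mem hx (P.smul_mem (ε * (l - 1) * B δ₂ x) hδ₂P)
      rwa [add_sub_cancel_right] at this
  -- restriction `Γ₀ → GL₂(ℂ) → PGL₂(ℂ)`
  let ρ : Γ₀ →* GL (Fin 2) ℂ := restrictGL P b Γ₀ hstab
  let π : Γ₀ →* PGL(Fin 2, ℂ) := Matrix.ProjGenLinGroup.mk.comp ρ
  have hγ₁m : g₁ ∈ Γ₀ := Subgroup.subset_closure (Set.mem_insert _ _)
  have hγ₂m : g₂ ∈ Γ₀ := Subgroup.subset_closure (Set.mem_insert_of_mem _ rfl)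
  set γ₁ : Γ₀ := ⟨g₁, hγ₁m⟩ with hγ₁_def
  set γ₂ : Γ₀ := ⟨g₂, hγ₂m⟩ with hγ₂_def
  have hcen : ∀ γ : Γ₀, π γ = 1 → ∃ u : ℂ, ∀ x ∈ P, γ.1 x = u • x := fun γ hγ =>
    exists_smul_of_restrictGL_mem_center P b Γ₀ hstab (Matrix.ProjGenLinGroup.mk_eq_one.mp hγ)
  -- (i) the images of the reflections are non-trivial in `PGL₂`
  have hne₁ : π γ₁ ≠ 1 := by
    intro h
    obtain ⟨u, hu⟩ := hcen γ₁ h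
    have h2 : g₁ δ₂ = u • δ₂ := hu δ₂ hδ₂P
    rw [g₁δ₂] at h2
    have h0 : a • δ₁ + (1 : ℂ) • δ₂ = (0 : ℂ) • δ₁ + u • δ₂ := by
      rw [one_smul, zero_smul, zero_add, add_comm]; exact h2
    exact ha0 (hli.eq_of_pair h0).1
  have hne₂ : π γ₂ ≠ 1 := by
    intro h
    obtain ⟨u, hu⟩ := hcen γ₂ h
    have h2 : g₂ δ₁ = u • δ₁ := hu δ₁ hδ₁P
    rw [g₂δ₁] at h2
    have h0 : (1 : ℂ) • δ₁ + c • δ₂ = u • δ₁ + (0 : ℂ) • δ₂ := by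
      rw [one_smul, zero_smul, add_zero]; exact h2
    exact hc0 (hli.eq_of_pair h0).2
  -- (ii) they have order dividing `p`
  have hγ₁p : γ₁ ^ p = 1 := Subtype.ext (pow_eq_one_of_coe_eq_complexReflection B hε hlp hδ₁ hg₁e)
  have hγ₂p : γ₂ ^ p = 1 := Subtype.ext (pow_eq_one_of_coe_eq_complexReflection B hε hlp hδ₂ hg₂e)
  -- (iii) their images do NOT commute in `PGL₂`
  have hnc : π γ₁ * π γ₂ ≠ π γ₂ * π γ₁ := by
    intro hcomm
    have hk : π (γ₁ * γ₂ * γ₁⁻¹ * γ₂⁻¹) = 1 := by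
      rw [map_mul, map_mul, map_mul, map_inv, map_inv, hcomm]; group
    obtain ⟨u, hu⟩ := hcen _ hk
    have key : ∀ y ∈ P, g₁ (g₂ y) = u • g₂ (g₁ y) := by
      intro y hy
      have hy' : g₂ (g₁ y) ∈ P := ((hstab hγ₂m) _).mp (((hstab hγ₁m) _).mp hy)
      have h1 := hu _ hy'
      have h2 : (γ₁ * γ₂ * γ₁⁻¹ * γ₂⁻¹ : Γ₀).1 (g₂ (g₁ y)) = g₁ (g₂ y) := by
        change (g₁ * g₂ * g₁⁻¹ * g₂⁻¹) (g₂ (g₁ y)) = g₁ (g₂ y)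
        change g₁ (g₂ (g₁.symm (g₂.symm (g₂ (g₁ y))))) = g₁ (g₂ y)
        rw [LinearEquiv.symm_apply_apply, LinearEquiv.symm_apply_apply]
      rw [← h2]; exact h1
    have k₂ := key δ₂ hδ₂P
    rw [g₂δ₂, map_smul, g₁δ₂, map_add, map_smul, g₂δ₂, g₂δ₁] at k₂
    have k₂' : (l * a) • δ₁ + l • δ₂ = (u * a) • δ₁ + (u * (l + a * c)) • δ₂ := by
      convert k₂ using 1 <;> module
    obtain ⟨q1, -⟩ := hli.eq_of_pair k₂'
    have hul : u = l := (mul_right_cancel₀ ha0 q1).symm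
    have k₁ := key δ₁ hδ₁P
    rw [g₂δ₁, map_add, map_smul, g₁δ₁, g₁δ₂, map_smul, g₂δ₁] at k₁
    have k₁' : (l + c * a) • δ₁ + c • δ₂ = (u * l) • δ₁ + (u * l * c) • δ₂ := by
      convert k₁ using 1 <;> module
    obtain ⟨-, r2⟩ := hli.eq_of_pair k₁'
    have hul1 : u * l = 1 := by
      have : (1 : ℂ) * c = (u * l) * c := by rw [one_mul]; exact r2
      exact (mul_right_cancel₀ hc0 this).symm
    exact hl2 (by rw [hul] at hul1; exact hul1)
  -- (iv) if `Γ₀` were finite, Klein's classification of finite subgroups of `PGL₂(ℂ)` gives a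
  -- contradiction
  suffices h0 : (Γ₀ : Set (W ≃ₗ[ℂ] W)).Infinite from h0.mono fun g hg => hΓ₀Γ hg
  intro hfin
  haveI : Finite Γ₀ := hfin.to_subtype
  set H : Subgroup PGL(Fin 2, ℂ) := π.range with hH_def
  haveI : Finite H := by
    rw [hH_def]
    exact Set.Finite.to_subtype (by rw [MonoidHom.coe_range]; exact Set.finite_range π)
  haveI : Fact p.Prime := ⟨hp⟩
  set x₁ : H := ⟨π γ₁, ⟨γ₁, rfl⟩⟩ with hx₁_def
  set x₂ : H := ⟨π γ₂, ⟨γ₂, rfl⟩⟩ with hx₂_def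
  have hx₁p : orderOf x₁ = p := by
    refine orderOf_eq_prime (Subtype.ext ?_) (fun h => hne₁ (congrArg Subtype.val h))
    change π γ₁ ^ p = 1
    rw [← map_pow, hγ₁p, map_one]
  have hx₂p : orderOf x₂ = p := by
    refine orderOf_eq_prime (Subtype.ext ?_) (fun h => hne₂ (congrArg Subtype.val h))
    change π γ₂ ^ p = 1
    rw [← map_pow, hγ₂p, map_one]
  have hx12 : x₁ * x₂ ≠ x₂ * x₁ := fun h => hnc (congrArg Subtype.val h)
  obtain ⟨h12', h24, h60⟩ := not_dvd_sixty_of_prime_ge_seven hp h7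
  have hcard4 : Nat.card (Fin 4) = 4 := by simp
  have hcard5 : Nat.card (Fin 5) = 5 := by simp
  rcases Literature.NumberTheory.GaloisRepresentations.klein_finite_subgroup_pgl_two_of_isAlgClosed H
    with hcyc | ⟨m, ⟨e⟩⟩ | hne | hne | hne
  · -- cyclic: abelian
    obtain ⟨g, hg⟩ := IsCyclic.exists_generator (α := H)
    obtain ⟨k₁, hk₁⟩ := Subgroup.mem_zpowers_iff.mp (hg x₁)
    obtain ⟨k₂, hk₂⟩ := Subgroup.mem_zpowers_iff.mp (hg x₂)
    exact hx12 (by rw [← hk₁, ← hk₂]; exact zpow_mul_comm g k₁ k₂)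
  · -- dihedral: elements of order `p > 2` are rotations, which commute
    have ho₁ : orderOf (e x₁) = p := by rw [MulEquiv.orderOf_eq]; exact hx₁p
    have ho₂ : orderOf (e x₂) = p := by rw [MulEquiv.orderOf_eq]; exact hx₂p
    obtain ⟨i, hi⟩ : ∃ i, e x₁ = DihedralGroup.r i := by
      cases h : e x₁ with
      | r i => exact ⟨i, rfl⟩
      | sr i => rw [h, DihedralGroup.orderOf_sr] at ho₁; omega
    obtain ⟨j, hj⟩ : ∃ j, e x₂ = DihedralGroup.r j := by
      cases h : e x₂ with
      | r j => exact ⟨j, rfl⟩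
      | sr j => rw [h, DihedralGroup.orderOf_sr] at ho₂; omega
    refine hx12 (e.injective ?_)
    rw [map_mul, map_mul, hi, hj, DihedralGroup.r_mul_r, DihedralGroup.r_mul_r, add_comm]
  · -- tetrahedral `𝔄₄`, order 12
    obtain ⟨e⟩ := hne
    have ho : orderOf (e x₁) = p := by rw [MulEquiv.orderOf_eq]; exact hx₁p
    have hd := orderOf_dvd_natCard (e x₁)
    rw [ho, nat_card_alternatingGroup, hcard4] at hd
    exact h12' hd
  · -- octahedral `𝔖₄`, order 24
    obtain ⟨e⟩ := hne
    have ho : orderOf (e x₁) = p := by rw [MulEquiv.orderOf_eq]; exact hx₁p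
    have hd := orderOf_dvd_natCard (e x₁)
    rw [ho, Nat.card_perm, hcard4] at hd
    exact h24 hd
  · -- icosahedral `𝔄₅`, order 60
    obtain ⟨e⟩ := hne
    have ho : orderOf (e x₁) = p := by rw [MulEquiv.orderOf_eq]; exact hx₁p
    have hd := orderOf_dvd_natCard (e x₁)
    rw [ho, nat_card_alternatingGroup, hcard5] at hd
    exact h60 hd

end PairInfinite


/-! ### §3 The density theorem without its finite branch (`λ` of prime order `p ≥ 7`) -/

section Density

variable {W : Type} [AddCommGroup W] [Module ℂ W] [FiniteDimensional ℂ W]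

/-- **Carlson–Toledo's density theorem for `λ` of prime order `p ≥ 7`, finite branch removed**:
under the hypotheses of Theorem `udensitytheo` (`carlsonToledo1999_unitaryReflection_zariskiDense`)
with `λ^p = 1`, `p` prime `≥ 7`, if `Δ` contains two linearly independent roots `δ₁, δ₂` with
`h(δ₂,δ₁) ≠ 0`, then `Γ` is infinite (`infinite_of_two_complexReflections`) and so every `h`-unitary
automorphism of `W` lies in the real Zariski closure of `Γ·U(1)` ("PΓ Zariski-dense in PU(p,q)").
[cite: CarlsonToledo1999, §7 Theorem udensitytheo and Lemma Ulemma] -/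
theorem carlsonToledo1999_unitaryReflection_zariskiDense.mem_glZariskiClosure_of_prime
    (hCT : carlsonToledo1999_unitaryReflection_zariskiDense) {B : W →ₗ⋆[ℂ] W →ₗ[ℂ] ℂ}
    (hB : B.IsSymm) (hBn : B.Nondegenerate) (hW : 2 ≤ finrank ℂ W) {ε : ℂ} (hε : ε = 1 ∨ ε = -1)
    {l : ℂ} {p : ℕ} (hp : p.Prime) (h7 : 7 ≤ p) (hlp : l ^ p = 1) (hl1 : l ≠ 1) {Δ : Set W}
    (hΔ : ∀ δ ∈ Δ, B δ δ = ε) (hspan : Submodule.span ℂ Δ = ⊤) {Γ : Subgroup (W ≃ₗ[ℂ] W)}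
    (hΓ : Γ = Subgroup.closure {g : W ≃ₗ[ℂ] W | ∃ δ ∈ Δ, (g : W →ₗ[ℂ] W) = complexReflection B ε l δ})
    (hstab : ∀ g ∈ Γ, ∀ δ ∈ Δ, g δ ∈ Δ) (htrans : ∀ δ ∈ Δ, ∀ δ' ∈ Δ, ∃ g ∈ Γ, g δ = δ')
    {δ₁ δ₂ : W} (hδ₁ : δ₁ ∈ Δ) (hδ₂ : δ₂ ∈ Δ) (h12 : B δ₁ δ₂ ≠ 0)
    (hli : LinearIndependent ℂ ![δ₁, δ₂]) {u : W ≃ₗ[ℂ] W} (hu : ∀ x y, B (u x) (u y) = B x y) :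
    restrictScalarsRealHom W u ∈ glZariskiClosure (realPointsWithUnitScalars W Γ) := by
  have hε2 : ε * ε = 1 := (sign_mul_self_and_conj hε).1
  have hl0 : l ≠ 0 := by
    rintro rfl
    rw [zero_pow hp.ne_zero] at hlp
    exact zero_ne_one hlp
  have hl2 : l ≠ -1 := by
    intro h
    apply mul_self_ne_one_of_pow_prime_eq_one hp h7 hlp hl1
    rw [h]; norm_num
  have hg₁ : complexReflectionEquiv B hε2 hl0 (hΔ δ₁ hδ₁) ∈ Γ := by
    rw [hΓ]; exact complexReflectionEquiv_mem_closure B hε2 hl0 hΔ hδ₁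
  have hg₂ : complexReflectionEquiv B hε2 hl0 (hΔ δ₂ hδ₂) ∈ Γ := by
    rw [hΓ]; exact complexReflectionEquiv_mem_closure B hε2 hl0 hΔ hδ₂
  have hinf : (Γ : Set (W ≃ₗ[ℂ] W)).Infinite :=
    infinite_of_two_complexReflections hB hε2 hp h7 hlp hl1 (hΔ δ₁ hδ₁) (hΔ δ₂ hδ₂) h12 hli hg₁ hg₂
      (coe_complexReflectionEquiv B hε2 hl0 (hΔ δ₁ hδ₁))
      (coe_complexReflectionEquiv B hε2 hl0 (hΔ δ₂ hδ₂))
  exact hCT.mem_glZariskiClosure_of_infinite hB hBn hW hε ⟨p, hp.pos, hlp⟩ hl1 hl2 hΔ hspan hΓ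
    hstab htrans hinf hu

end Density

/-! ### §4 A single orbit of unit roots spanning a space of dimension `≥ 2` contains a skew pair -/

section SkewPair

variable {W : Type*} [AddCommGroup W] [Module ℂ W]

/-- The inverse of an automorphism with underlying map `s^λ_δ` has underlying map `s^{λ⁻¹}_δ`
(`s^λ_δ ∘ s^{λ⁻¹}_δ = id`). [cite: CarlsonToledo1999, §7 Theorem udensitytheo] -/
theorem coe_inv_eq_complexReflection (B : W →ₗ⋆[ℂ] W →ₗ[ℂ] ℂ) {ε : ℂ} (hε : ε * ε = 1) {l : ℂ}
    (hl : l ≠ 0) {δ : W} (hδ : B δ δ = ε) {g : W ≃ₗ[ℂ] W}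
    (hge : (g : W →ₗ[ℂ] W) = complexReflection B ε l δ) :
    ((g⁻¹ : W ≃ₗ[ℂ] W) : W →ₗ[ℂ] W) = complexReflection B ε l⁻¹ δ := by
  ext y
  apply g.injective
  change g (g.symm y) = g (complexReflection B ε l⁻¹ δ y)
  rw [LinearEquiv.apply_symm_apply, ← LinearEquiv.coe_coe, hge, ← LinearMap.comp_apply,
    complexReflection_comp B hε _ _ hδ, mul_inv_cancel₀ hl, complexReflection_one, LinearMap.id_apply]

/-- **A transitive system of unit roots spanning a space of dimension `≥ 2` contains a skew pair**:
if `Γ` lies in the group generated by the `λ`-reflections along the unit roots `δ ∈ Δ`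
(`h(δ,δ) = ε`, `ε² = 1`, `λ ≠ 0`), `Γ` is transitive on `Δ`, and `Δ` spans `W` with `dim W ≥ 2`, then
some `δ₁, δ₂ ∈ Δ` are linearly independent with `h(δ₂,δ₁) ≠ 0`.  (Otherwise every reflection along a
root maps the line `ℂδ₀` of a fixed root into itself — a root is proportional or orthogonal to `δ₀` —
so `Δ = Γδ₀ ⊆ ℂδ₀` and `W = span Δ` would be a line: the source's "the cyclic groups, where the
vectors `δ` are all proportional".)  This discharges the extra hypothesis of
`carlsonToledo1999_unitaryReflection_zariskiDense.mem_glZariskiClosure_of_prime`.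
[cite: CarlsonToledo1999, §7 Lemma Ulemma (p. 15 L72–74) and Theorem udensitytheo] -/
theorem exists_skew_pair_of_transitive [FiniteDimensional ℂ W] {B : W →ₗ⋆[ℂ] W →ₗ[ℂ] ℂ} {ε : ℂ}
    (hε : ε * ε = 1) {l : ℂ} (hl : l ≠ 0) {Δ : Set W} (hΔ : ∀ δ ∈ Δ, B δ δ = ε)
    (hspan : Submodule.span ℂ Δ = ⊤) (hW : 2 ≤ finrank ℂ W) {Γ : Subgroup (W ≃ₗ[ℂ] W)}
    (hΓ : Γ ≤ Subgroup.closure {g : W ≃ₗ[ℂ] W | ∃ δ ∈ Δ, (g : W →ₗ[ℂ] W) = complexReflection B ε l δ})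
    (htrans : ∀ δ ∈ Δ, ∀ δ' ∈ Δ, ∃ g ∈ Γ, g δ = δ') :
    ∃ δ₁ ∈ Δ, ∃ δ₂ ∈ Δ, LinearIndependent ℂ ![δ₁, δ₂] ∧ B δ₁ δ₂ ≠ 0 := by
  by_contra hno
  push Not at hno
  have hε0 : ε ≠ 0 := by rintro rfl; norm_num at hε
  have hΔne : Δ.Nonempty := by
    by_contra h
    rw [Set.not_nonempty_iff_eq_empty] at h
    rw [h, Submodule.span_empty] at hspan
    have : finrank ℂ W = 0 := by rw [← finrank_top ℂ W, ← hspan, finrank_bot]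
    omega
  obtain ⟨δ₀, hδ₀⟩ := hΔne
  have hδne : ∀ δ ∈ Δ, δ ≠ 0 := by
    intro δ hδ h0
    have := hΔ δ hδ
    rw [h0, map_zero] at this
    exact hε0 (by simpa using this.symm)
  set L : Submodule ℂ W := ℂ ∙ δ₀ with hL_def
  have hδ₀L : δ₀ ∈ L := Submodule.mem_span_singleton_self δ₀
  -- every reflection along a root maps the line `L = ℂδ₀` into itself
  have key : ∀ δ ∈ Δ, ∀ m : ℂ, ∀ x ∈ L, complexReflection B ε m δ x ∈ L := by
    intro δ hδ m x hx
    rw [complexReflection_apply]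
    obtain ⟨c, rfl⟩ := Submodule.mem_span_singleton.mp hx
    by_cases hind : LinearIndependent ℂ ![δ, δ₀]
    · have h0 : B δ δ₀ = 0 := hno δ hδ δ₀ hδ₀ hind
      rw [map_smul, h0, smul_eq_mul, mul_zero, mul_zero, zero_smul, add_zero]
      exact L.smul_mem c hδ₀L
    · have hδL : δ ∈ L := by
        rw [LinearIndependent.pair_iff] at hind
        push Not at hind
        obtain ⟨s, t, hst, hst0⟩ := hind
        have hs : s ≠ 0 := by
          intro hs
          rw [hs, zero_smul, zero_add] at hst
          exact hst0 hs ((smul_eq_zero.mp hst).resolve_right (hδne δ₀ hδ₀))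
        have hδeq : δ = (-(t / s)) • δ₀ := by
          have h1 : s • δ = -(t • δ₀) := eq_neg_of_add_eq_zero_left hst
          have h2 : δ = s⁻¹ • (s • δ) := by rw [smul_smul, inv_mul_cancel₀ hs, one_smul]
          rw [h2, h1, smul_neg, smul_smul, neg_smul, div_eq_inv_mul]
        rw [hδeq]
        exact L.smul_mem _ hδ₀L
      exact L.add_mem (L.smul_mem c hδ₀L) (L.smul_mem _ hδL)
  -- hence the generating automorphisms, and all of `Γ`, map `L` onto itself
  have hgen : Subgroup.closure {g : W ≃ₗ[ℂ] W | ∃ δ ∈ Δ, (g : W →ₗ[ℂ] W) = complexReflection B ε l δ}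
      ≤ submoduleStabilizer L := by
    rw [Subgroup.closure_le]
    rintro g ⟨δ, hδ, hge⟩ x
    refine ⟨fun hx => ?_, fun hx => ?_⟩
    · have := key δ hδ l x hx
      rwa [← hge, LinearEquiv.coe_coe] at this
    · have hinv := coe_inv_eq_complexReflection B hε hl (hΔ δ hδ) hge
      have := key δ hδ l⁻¹ (g x) hx
      rw [← hinv, LinearEquiv.coe_coe] at this
      change g.symm (g x) ∈ L at this
      rwa [LinearEquiv.symm_apply_apply] at this
  have hΔL : Δ ⊆ L := by
    intro δ hδ
    obtain ⟨g, hg, hgδ⟩ := htrans δ₀ hδ₀ δ hδ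
    rw [← hgδ]
    exact ((hgen (hΓ hg)) δ₀).mp hδ₀L
  have htop : (⊤ : Submodule ℂ W) ≤ L := by
    rw [← hspan]
    exact Submodule.span_le.mpr hΔL
  have h1 : finrank ℂ W ≤ 1 :=
    calc finrank ℂ W = finrank ℂ (⊤ : Submodule ℂ W) := (finrank_top ℂ W).symm
      _ ≤ finrank ℂ L := Submodule.finrank_mono htop
      _ = 1 := finrank_span_singleton (hδne δ₀ hδ₀)
  omega

end SkewPair

section DensityPrime

variable {W : Type} [AddCommGroup W] [Module ℂ W] [FiniteDimensional ℂ W]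

/-- **Carlson–Toledo's density theorem for `λ` of prime order `p ≥ 7` — the finite branch removed,
under exactly the hypotheses of Theorem `udensitytheo`**: `h` non-degenerate hermitian on `W`,
`dim W ≥ 2`, `ε = ±1`, `λ^p = 1 ≠ λ` with `p` prime `≥ 7`, `Δ` in the unit quadric `h(δ,δ) = ε` spanning
`W`, `Γ` generated by the `λ`-reflections along `Δ`, `Δ` a single `Γ`-orbit ⇒ every `h`-unitary
automorphism lies in the real Zariski closure of `Γ·U(1)` ("`PΓ` Zariski-dense in `PU(p,q)`"): the
orbit contains a skew pair (`exists_skew_pair_of_transitive`), the two reflections generate an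
infinite group (`infinite_of_two_complexReflections`), and the named fact
`carlsonToledo1999_unitaryReflection_zariskiDense` applies.
[cite: CarlsonToledo1999, §7 Theorem udensitytheo and Lemma Ulemma] -/
theorem carlsonToledo1999_unitaryReflection_zariskiDense.mem_glZariskiClosure_of_prime_order
    (hCT : carlsonToledo1999_unitaryReflection_zariskiDense) {B : W →ₗ⋆[ℂ] W →ₗ[ℂ] ℂ}
    (hB : B.IsSymm) (hBn : B.Nondegenerate) (hW : 2 ≤ finrank ℂ W) {ε : ℂ} (hε : ε = 1 ∨ ε = -1)
    {l : ℂ} {p : ℕ} (hp : p.Prime) (h7 : 7 ≤ p) (hlp : l ^ p = 1) (hl1 : l ≠ 1) {Δ : Set W}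
    (hΔ : ∀ δ ∈ Δ, B δ δ = ε) (hspan : Submodule.span ℂ Δ = ⊤) {Γ : Subgroup (W ≃ₗ[ℂ] W)}
    (hΓ : Γ = Subgroup.closure {g : W ≃ₗ[ℂ] W | ∃ δ ∈ Δ, (g : W →ₗ[ℂ] W) = complexReflection B ε l δ})
    (hstab : ∀ g ∈ Γ, ∀ δ ∈ Δ, g δ ∈ Δ) (htrans : ∀ δ ∈ Δ, ∀ δ' ∈ Δ, ∃ g ∈ Γ, g δ = δ')
    {u : W ≃ₗ[ℂ] W} (hu : ∀ x y, B (u x) (u y) = B x y) :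
    restrictScalarsRealHom W u ∈ glZariskiClosure (realPointsWithUnitScalars W Γ) := by
  have hε2 : ε * ε = 1 := (sign_mul_self_and_conj hε).1
  have hl0 : l ≠ 0 := by
    rintro rfl
    rw [zero_pow hp.ne_zero] at hlp
    exact zero_ne_one hlp
  obtain ⟨δ₁, hδ₁, δ₂, hδ₂, hli, h12⟩ :=
    exists_skew_pair_of_transitive hε2 hl0 hΔ hspan hW (hΓ ▸ le_rfl) htrans
  exact hCT.mem_glZariskiClosure_of_prime hB hBn hW hε hp h7 hlp hl1 hΔ hspan hΓ hstab htrans hδ₁ hδ₂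
    h12 hli hu

end DensityPrime

end Literature.AlgebraicGeometry.HodgeTheory
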